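import Literature.MathematicalPhysics.QuantumLattice.HubbardVertexFieldSubstitution
import Literature.MathematicalPhysics.QuantumLattice.GrassmannLaplacianPairWick
import Literature.MathematicalPhysics.QuantumLattice.GrassmannLinearSubstitution
import HarnessLib

/-!
# Wick's rule for products of Hubbard vertex fields: Gaussian expectations are determinants of truncated propagators

Topic `MathematicalPhysics/QuantumLattice`; the Grassmann-side second step of the `M → ∞` ("Matsubara UV") bridge
(after `HubbardVertexFieldSubstitution`).  For `n` interaction vertices at real space–time points `(x⃗_a, τ_a)` the
position–time fields are `map (toLin' S) (gen ((a,σ),c))`, `S = vertexSubMatrix β x τ`; a product of pairs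
`ψ⁺_{(a,σ)} ψ⁻_{(a,σ)}` (in any enumeration `P` of (vertex, spin) pairs — the Hubbard vertex is the case
`(a,↑),(a,↓)`) is the image of the paired monomial `genPairProd`, and its Gaussian expectation under the zero-seed
free covariance `C_M = hubbardCovariance L M β μ 0` is a DETERMINANT of truncated position–time propagators
(Benfatto–Giuliani–Mastropietro 2006, (2.6)–(2.8): the coefficients of the expansion in `U` are
`∫dx Σ det g_M(x_i − x_j)`):

* `gaussExpect_map` — `∫dμ_C (F ∘ S) = ∫dμ_{SᵀCS} F` (`gaussConv_map` + `constPart_map`);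
* `contr_vertexSub_pullback_zero_one` — the contraction of a `ψ⁺` and a `ψ⁻` vertex leg is minus the `(+,−)` entry
  of `Sᵀ C S` (antisymmetry), `contr_vertexSub_pullback_of_charge_eq` — equal charges do not contract;
* **`gaussExpect_vertexPairWord_eq_det`** —
  `∫dμ_{C_M} Πᵢ ψ⁺_{P i} ψ⁻_{P i} = det [ -(Sᵀ C_M S)((P i, +), (P j, −)) ]_{i,j}`, whose entries are
  `-[σᵢ = σⱼ] (1/L²) Σ_k⃗ e^{ip·(x⃗_{aᵢ}−x⃗_{aⱼ})} (1/β) Σ_ω e^{-iω(τ_{aⱼ}−τ_{aᵢ})}/(-iω + ξ_k⃗)`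
  (`vertexSub_pullback_zero_seed_apply_zero_one`), i.e. `-g_M(x_{aⱼ} − x_{aᵢ})`.

With `tendsto_vertexSub_pullback_zero_seed_zero_one(_neg)` / `norm_…_le` and
`Literature.Analysis.Matrix.tendsto_integral_cube_det` the time-integrated coefficients converge as `M → ∞`; that
assembly and the bookkeeping `𝔼[V^k] = U^k Σ_x⃗ ∫ 𝔼[Π W]` are NOT here.  Everything is proved; no definitions.

## Sources

G. Benfatto, A. Giuliani, V. Mastropietro, Ann. Henri Poincaré 7 (2006) 809–898, §2.1 (2.3)–(2.8)
[`BenfattoGiulianiMastropietro2006`]; J. Feldman, H. Knörrer, E. Trubowitz, *Fermionic Functional Integrals and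
the Renormalization Group* (2002), §I.3 Prop. I.18 (determinant Wick rule) [`FeldmanKnorrerTrubowitz2002`];
M. Salmhofer, *Renormalization* (1999), App. B.2 (B.23)–(B.25) [`Salmhofer1999`].
-/

noncomputable section

namespace Literature.MathematicalPhysics.QuantumLattice

open GrassmannAlgebra Finset Literature.Probability.LatticeModels
open scoped ComplexConjugate

/-! ### Gaussian expectations under a linear substitution -/

section Generic

variable (R : Type*) [CommRing R] [Algebra ℚ R] {Γ Γ' : Type*} [Fintype Γ] [DecidableEq Γ] [Fintype Γ'] [DecidableEq Γ']

omit [DecidableEq Γ'] in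
/-- **Gaussian expectations are covariant under linear substitutions of the fields**:
`∫ dμ_C (map f F) = ∫ dμ_{Mᵀ C M} F`, `M = toMatrix' f` (Salmhofer 1999, (B.23)–(B.25); `gaussConv_map` read
through the constant part). [cite: Salmhofer1999, App. B.2 (B.23)-(B.25)] -/
theorem gaussExpect_map (f : (Γ → R) →ₗ[R] (Γ' → R)) (C : Matrix Γ' Γ' R) (F : GrassmannAlgebra R Γ) :
    gaussExpect R C (ExteriorAlgebra.map f F) =
      gaussExpect R ((LinearMap.toMatrix' f).transpose * C * LinearMap.toMatrix' f) F := by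
  rw [gaussExpect_apply, gaussConv_map, constPart_map, gaussExpect_apply]

omit [DecidableEq Γ'] in
/-- The same for a substitution MATRIX `S` (`f = toLin' S`): `∫ dμ_C (F ∘ S) = ∫ dμ_{Sᵀ C S} F`. [folklore] -/
theorem gaussExpect_map_toLin' (S : Matrix Γ' Γ R) (C : Matrix Γ' Γ' R) (F : GrassmannAlgebra R Γ) :
    gaussExpect R C (ExteriorAlgebra.map (Matrix.toLin' S) F) = gaussExpect R (S.transpose * C * S) F := by
  rw [gaussExpect_map, LinearMap.toMatrix'_toLin']

end Generic

/-! ### Contractions of vertex legs -/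

section Vertex

variable {L M : ℕ} [NeZero L]

/-- `(½ • 1) · (−z − z) = −z` in `ℂ`. [folklore] -/
theorem half_smul_one_mul_neg_sub_self (z : ℂ) : ((1 / 2 : ℚ) • (1 : ℂ)) * (-z - z) = -z := by
  rw [show (-z - z) = -(2 * z) by ring, mul_neg, ← mul_assoc, show ((1 / 2 : ℚ) • (1 : ℂ)) * 2 = 1 by norm_num,
    one_mul]

/-- **The contraction of a `ψ⁺` leg with a `ψ⁻` leg** of the vertex fields under a normal covariance is minus the
`(+, −)` entry of the pulled-back covariance: `∫dμ ψ⁺_Y ψ⁻_{Y'} = ½((SᵀCS)(Y',Y) − (SᵀCS)(Y,Y')) = −(SᵀCS)(Y,Y')`.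
[folklore] -/
theorem contr_vertexSub_pullback_zero_one (β : ℝ) {n : ℕ} (x : Fin n → TorusSite 2 L) (τ : Fin n → ℝ)
    (p : FreqMomentum L M × Fin 2 → ℂ) (a b : Fin n) (σ σ' : Fin 2) :
    contr ℂ ((vertexSubMatrix L M β x τ).transpose * normalCovariance L M p * vertexSubMatrix L M β x τ)
        ((a, σ), 0) ((b, σ'), 1) =
      -((vertexSubMatrix L M β x τ).transpose * normalCovariance L M p * vertexSubMatrix L M β x τ)
        ((a, σ), 0) ((b, σ'), 1) := by
  rw [contr_apply, vertexSub_pullback_normalCovariance_apply_one_zero, half_smul_one_mul_neg_sub_self]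

/-- **Legs of equal charge do not contract**. [folklore] -/
theorem contr_vertexSub_pullback_of_charge_eq (β : ℝ) {n : ℕ} (x : Fin n → TorusSite 2 L) (τ : Fin n → ℝ)
    (p : FreqMomentum L M × Fin 2 → ℂ) {Y Y' : VertexLeg n} (h : Y.2 = Y'.2) :
    contr ℂ ((vertexSubMatrix L M β x τ).transpose * normalCovariance L M p * vertexSubMatrix L M β x τ) Y Y' = 0 := by
  rw [contr_apply, vertexSub_pullback_normalCovariance_apply_of_charge_eq β x τ p h,
    vertexSub_pullback_normalCovariance_apply_of_charge_eq β x τ p h.symm, sub_zero, mul_zero]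

/-! ### Wick's rule for paired vertex words -/

/-- **Wick's rule for a product of `ψ⁺ψ⁻` pairs of vertex fields** under the zero-seed free covariance: for any
enumeration `P : Fin m → Fin n × Fin 2` of (vertex, spin) pairs,
`∫dμ_{C_M} Πᵢ ψ⁺_{P i} ψ⁻_{P i} = det [ −(Sᵀ C_M S)((P i, +), (P j, −)) ]_{i,j}` — a determinant of TRUNCATED
position–time propagators (BGM 2006, (2.6)–(2.8) at frequency cutoff `M`; the determinant Wick rule
`gaussExpect_genPairProd` after the substitution `gaussExpect_map_toLin'`; the `ψ⁺` legs do not contract among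
themselves). [cite: BenfattoGiulianiMastropietro2006, §2.1 (2.6)-(2.8)] -/
theorem gaussExpect_vertexPairWord_eq_det (β μ : ℝ) {n m : ℕ} (x : Fin n → TorusSite 2 L) (τ : Fin n → ℝ)
    (P : Fin m → Fin n × Fin 2) :
    gaussExpect ℂ (hubbardCovariance L M β μ 0)
        (ExteriorAlgebra.map (Matrix.toLin' (vertexSubMatrix L M β x τ))
          (genPairProd ℂ (fun i => ((P i, 0) : VertexLeg n)) (fun i => ((P i, 1) : VertexLeg n)))) =
      (Matrix.of fun i j => -((vertexSubMatrix L M β x τ).transpose * hubbardCovariance L M β μ 0 *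
        vertexSubMatrix L M β x τ) ((P i, 0) : VertexLeg n) ((P j, 1) : VertexLeg n)).det := by
  rw [gaussExpect_map_toLin', hubbardCovariance_zero_seed]
  rw [gaussExpect_genPairProd]
  · congr 1
    ext i j
    simp only [Matrix.of_apply]
    obtain ⟨a, σ⟩ := P i
    obtain ⟨b, σ'⟩ := P j
    exact contr_vertexSub_pullback_zero_one β x τ _ a b σ σ'
  · intro i j
    exact contr_vertexSub_pullback_of_charge_eq β x τ _ rfl

/-- The entries of the Wick determinant in closed form (`β ≠ 0`): minus the truncated position–time propagator,
`-(Sᵀ C_M S)((a,σ,+),(b,σ',−)) = -[σ = σ'] (1/L²) Σ_k⃗ e^{ip·(x⃗_a−x⃗_b)} (1/β) Σᵢ e^{-iωᵢ(τ_b−τ_a)}/(-iωᵢ + ξ_k⃗)`.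
[cite: BenfattoGiulianiMastropietro2006, §2.1 (2.3)-(2.4)] -/
theorem vertexWickEntry_eq {β : ℝ} (hβ : β ≠ 0) (μ : ℝ) {n : ℕ} (x : Fin n → TorusSite 2 L) (τ : Fin n → ℝ)
    (a b : Fin n) (σ σ' : Fin 2) :
    -((vertexSubMatrix L M β x τ).transpose * hubbardCovariance L M β μ 0 * vertexSubMatrix L M β x τ)
        ((a, σ), 0) ((b, σ'), 1) =
      -(if σ = σ' then ((1 / (L : ℝ) ^ 2 : ℝ) : ℂ) * ∑ q : TorusSite 2 L,
        Complex.exp (((∑ j, latticeMomentum L q j * (((x a j).val : ℝ) - ((x b j).val : ℝ)) : ℝ) : ℂ) * Complex.I) *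
          ((1 / (β : ℂ)) * ∑ i : MatsubaraIdx M, Complex.exp (-(Complex.I * matsubaraFreq β M i * ((τ b - τ a : ℝ) : ℂ))) *
            (1 / (-(Complex.I * matsubaraFreq β M i) + nambuXi L μ q)))
        else 0) := by
  rw [vertexSub_pullback_zero_seed_apply_zero_one hβ]

end Vertex

end Literature.MathematicalPhysics.QuantumLattice
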